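import Summits.MatrixMultiplication.OmegaCensus.SmallFormats.InvertiblePointHalfLaw
import Summits.MatrixMultiplication.OmegaCensus.SmallFormats.InvertiblePointNearDeltaLaw
import HarnessLib

/-!
# ω-census family (a): the HALF LAW PLUS ONE — `11n + 1 ≤ 2r + 2p` at every non-saturated invertible point (any field)

Cell `pub-omega` (unit `pub-omega-tensor`, gen 36), topic `Summits/MatrixMultiplication/OmegaCensus` (sub-folder
`SmallFormats`). Framing (verbatim): lottery ticket; floor = certified bounds/negative ranges. HONEST FRAMING: tensor g35's
iterated split (`InvertiblePointHalfLaw`, p666834) with the base case replaced: instead of splitting all the way down to a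
saturated point and applying the refined δ-law, stop at a NEAR point and apply the NEAR REFINED δ-LAW
(`DeltaLaw.near_finrank_ker_add_le`, p680438), which does not lose the last kernel dimension. Result
(`finrank_add_three_mul_succ_le`): at `X₀ = 1` with `|O| = 2n + d`, `d ≥ 1`, every subspace `K` killed by the `g_t`, `t ∉ O`,
has `dim K + 3n + 1 ≤ |ι| + 3d` (g35: without the `+ 1`). Hence **the half law plus one** (`eleven_mul_add_one_le`, any field):
at every invertible point with `p ≥ 2n + 1` nonvanishing X-forms, `11n + 1 ≤ 2r + 2p`; census form
(`two_mul_add_succ_le_card_filter_ne'`): if `2r < 7n` and `2r + 2q ≤ 7n` then every invertible point has at least `2n + q + 1`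
nonvanishing X-forms. For the `𝔽₃` floor rungs `(n, ⌈36n/11⌉)` this lowers the invertible-line cap by ONE for every EVEN `n`
(`11n − 2r` even; `⟨2,2,8⟩@27 ≥ 18` is already `DeltaLaw.eighteen_le_card_filter_ne_228_27`): 33-term `⟨2,2,10⟩` ≥ 23, 40-term `⟨2,2,12⟩` ≥ 27, 46-term `⟨2,2,14⟩` ≥ 32 nonvanishing
(at most 9, 10, 13, 14 vanish). Desk (tensor g36 `ddefect.py`): the bookkeeping is tight — on the cell's `𝔽₃` schemes the
deficit `dim K₀ + n − dim 𝒲⁺` reaches `d − 1` at `d = 2, 3`. Nothing here is a bound on `ω`; count-level consequences are not in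
this file.
-/

namespace Summit.MatrixMultiplication.OmegaCensus.SmallFormats

open Module Matrix Literature.Computability.AlgebraicComplexity
open Summit.MatrixMultiplication.OmegaCensus.RankOnePlaneCapGeneral

namespace NearSplit

variable {k : Type*} [Field k] {n : ℕ}

/-- **Iterated split down to a near point (field with enough points).** At `X₀ = 1` with `|O| = 2n + (d + 1)`: every subspace `K`
killed by all `g_t`, `t ∉ O`, has `dim K + 3n + 1 ≤ |ι| + 3(d + 1)`. (Induction on `d`: the split lowers `d` by one, raises `|ι|`
by two and costs at most one dimension of `K`; `d = 0` is the near refined δ-law with `dim 𝒲⁺ ≤ |Z| + 3`.) -/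
theorem finrank_add_three_mul_succ_le (P : ℕ) (xs : Fin (P + 1) → (Fin 2 → k))
    (hxs : ∀ i j, i ≠ j → xs i 0 * xs j 1 - xs i 1 * xs j 0 ≠ 0) (d : ℕ) :
    ∀ {ι : Type*} [Fintype ι] [DecidableEq ι], Fintype.card ι + 2 * d + 2 ≤ P →
      ∀ (β : BilinComp (mulBilin k 2 2 n) ι) (O : Finset ι),
      (∀ i, i ∉ O → β.f i 1 = 0) → (∀ i ∈ O, β.f i 1 ≠ 0) → O.card = 2 * n + (d + 1) →
      ∀ (K : Submodule k (Matrix (Fin 2) (Fin n) k)), (∀ W ∈ K, ∀ t, t ∉ O → β.g t W = 0) →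
      finrank k K + 3 * n + 1 ≤ Fintype.card ι + 3 * (d + 1) := by
  induction d with
  | zero =>
    intro ι _ _ hP β O hO hO' hcard K hK
    classical
    have hcard' : O.card = 2 * n + 1 := by rw [hcard]
    obtain ⟨ρ, σ, -, hrel, hfr, -⟩ := exists_nearFrame β O hO hcard'
    have h := DeltaLaw.near_finrank_ker_add_le P xs hxs (by omega) β O hO hO' hcard' hfr hrel
    set K₀ := LinearMap.ker (LinearMap.pi fun t : ↥(Finset.univ \ O) => β.g (t : ι)) with hK₀
    have hKle : K ≤ K₀ := by
      intro W hW
      rw [hK₀, LinearMap.mem_ker]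
      funext t
      simpa using hK W hW t (Finset.mem_sdiff.mp t.2).2
    have h1 := Submodule.finrank_mono hKle
    have h2 := finrank_sup_defect_le β O ρ
    have h3 : O.card ≤ Fintype.card ι := Finset.card_le_univ O
    omega
  | succ d ih =>
    intro ι _ _ hP β O hO hO' hcard K hK
    classical
    obtain ⟨ρ, hrel, j₀, hj₀, hρ⟩ := exists_relation β O (by omega)
    let β' := split (β := β) (ρ := ρ) (j₀ := j₀) O hO hO' hrel hj₀ hρ
    set O' : Finset (ι ⊕ Fin 2) := (O.erase j₀).map Function.Embedding.inl with hO'def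
    have hcard' : O'.card = 2 * n + (d + 1) := by
      rw [hO'def, Finset.card_map, Finset.card_erase_of_mem hj₀, hcard]; omega
    set K' : Submodule k (Matrix (Fin 2) (Fin n) k) := K ⊓ LinearMap.ker (β.g j₀) with hK'def
    have hK' : ∀ W ∈ K', ∀ t, t ∉ O' → β'.g t W = 0 := by
      intro W hW t ht
      obtain ⟨hWK, hWj⟩ := Submodule.mem_inf.mp hW
      rw [LinearMap.mem_ker] at hWj
      rcases t with s | i
      · change splitG β ρ j₀ (Sum.inl s) W = 0
        by_cases hs : s = j₀
        · simp only [splitG, Sum.elim_inl, if_pos hs, LinearMap.smul_apply, hWj, smul_zero]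
        · have hsO : s ∉ O := by
            intro hsO
            exact ht (Finset.mem_map.mpr ⟨s, Finset.mem_erase.mpr ⟨hs, hsO⟩, rfl⟩)
          simp only [splitG, Sum.elim_inl, if_neg hs, LinearMap.sub_apply, LinearMap.smul_apply, hK W hWK s hsO, hWj,
            smul_zero, sub_zero]
      · change splitG β ρ j₀ (Sum.inr i) W = 0
        simp only [splitG, Sum.elim_inr, LinearMap.smul_apply, hWj, smul_zero]
    have hP' : Fintype.card (ι ⊕ Fin 2) + 2 * d + 2 ≤ P := by rw [Fintype.card_sum, Fintype.card_fin]; omega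
    have h := ih hP' β' O' (split_f_one_eq_zero O hO hO' hrel hj₀ hρ) (split_f_one_ne_zero O hO hO' hrel hj₀ hρ) hcard' K' hK'
    rw [Fintype.card_sum, Fintype.card_fin] at h
    have hcut := finrank_le_finrank_inf_ker_add_one K (β.g j₀)
    rw [← hK'def] at hcut
    omega

/-- **`|O| = 2n + (d + 1)` at `X₀ = 1` forces `7n + 1 ≤ 2r + 2(d + 1)`** (field with more than `|ι| + 2d + 2` pairwise independent
vectors in `k²`): the iterated split with `K = ⋂_{t∉O} ker g_t`, `dim K ≥ 2n − |Z|`. -/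
theorem seven_mul_add_one_le_of_card (P : ℕ) (xs : Fin (P + 1) → (Fin 2 → k))
    (hxs : ∀ i j, i ≠ j → xs i 0 * xs j 1 - xs i 1 * xs j 0 ≠ 0) (d : ℕ) {ι : Type*} [Fintype ι] [DecidableEq ι]
    (hP : Fintype.card ι + 2 * d + 2 ≤ P) (β : BilinComp (mulBilin k 2 2 n) ι) (O : Finset ι)
    (hO : ∀ i, i ∉ O → β.f i 1 = 0) (hO' : ∀ i ∈ O, β.f i 1 ≠ 0) (hcard : O.card = 2 * n + (d + 1)) :
    7 * n + 1 ≤ 2 * Fintype.card ι + 2 * (d + 1) := by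
  classical
  set K₀ := LinearMap.ker (LinearMap.pi fun t : ↥(Finset.univ \ O) => β.g (t : ι)) with hK₀
  have hK : ∀ W ∈ K₀, ∀ t, t ∉ O → β.g t W = 0 := by
    intro W hW t ht
    rw [hK₀, LinearMap.mem_ker] at hW
    have := congr_fun hW ⟨t, Finset.mem_sdiff.mpr ⟨Finset.mem_univ t, ht⟩⟩
    simpa using this
  have h := finrank_add_three_mul_succ_le P xs hxs d hP β O hO hO' hcard K₀ hK
  have hdim := two_mul_le_finrank_ker_add_card β (Finset.univ \ O)
  rw [Finset.card_sdiff, Finset.inter_univ, Finset.card_univ, ← hK₀] at hdim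
  have hOle : O.card ≤ Fintype.card ι := Finset.card_le_univ O
  omega

section AnyField

variable {ι : Type*} [Fintype ι] [DecidableEq ι] [DecidableEq k]

/-- **THE HALF LAW PLUS ONE (any field).** For an `r`-term bilinear computation of `⟨2,2,n⟩` and an invertible `X₀` at which
`p ≥ 2n + 1` X-forms are nonzero (the point is not saturated): `11n + 1 ≤ 2r + 2p`. -/
theorem eleven_mul_add_one_le (β : BilinComp (mulBilin k 2 2 n) ι) (X₀ : Matrix (Fin 2) (Fin 2) k) (hX₀ : IsUnit X₀.det)
    (hp : 2 * n + 1 ≤ (Finset.univ.filter fun i => β.f i X₀ ≠ 0).card) :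
    11 * n + 1 ≤ 2 * Fintype.card ι + 2 * (Finset.univ.filter fun i => β.f i X₀ ≠ 0).card := by
  classical
  obtain ⟨d, hd⟩ := Nat.exists_eq_add_of_le hp
  let L := AlgebraicClosure k
  let φ : k →+* L := algebraMap k L
  let β₁ := DeltaLaw.baseChange22n φ β
  have hX₁ : IsUnit (X₀.map φ).det := DeltaLaw.isUnit_det_map φ hX₀
  have hcard₁ : (Finset.univ.filter fun i => β₁.f i (X₀.map φ) ≠ 0).card = 2 * n + (d + 1) := by
    rw [show (Finset.univ.filter fun i => β₁.f i (X₀.map φ) ≠ 0).card =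
      (Finset.univ.filter fun i => β.f i X₀ ≠ 0).card by convert DeltaLaw.card_filter_baseChange φ β X₀]
    rw [hd]; ring
  obtain ⟨β₂, hf, -, -⟩ := exists_XsideTransform β₁ (X₀.map φ) (X₀.map φ)⁻¹ 1 1
    (Matrix.mul_nonsing_inv _ hX₁) (Matrix.one_mul 1)
  have hf1 : ∀ i, β₂.f i 1 = β₁.f i (X₀.map φ) := fun i => by rw [hf, Matrix.mul_one, Matrix.mul_one]
  set O := Finset.univ.filter fun i => β₁.f i (X₀.map φ) ≠ 0 with hOdef
  have hO : ∀ i, i ∉ O → β₂.f i 1 = 0 := fun i hi => by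
    rw [hf1]; by_contra h; exact hi (Finset.mem_filter.mpr ⟨Finset.mem_univ i, h⟩)
  have hO' : ∀ i ∈ O, β₂.f i 1 ≠ 0 := fun i hi => by rw [hf1]; exact (Finset.mem_filter.mp hi).2
  let emb := Infinite.natEmbedding L
  let a : Fin (Fintype.card ι + 2 * d + 2 + 1) → L := fun i => emb i
  have ha : Function.Injective a := fun i j h => Fin.ext (emb.injective h)
  have h := seven_mul_add_one_le_of_card (Fintype.card ι + 2 * d + 2) (fun i => ![1, a i])
    (DeltaLaw.pairwise_indep_of_injective a ha) d le_rfl β₂ O hO hO' hcard₁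
  omega

/-- **Census form.** If `2r < 7n` and `2r + 2q ≤ 7n` then every invertible point of an `r`-term computation of `⟨2,2,n⟩` has at least
`2n + q + 1` nonvanishing X-forms (at most `r − 2n − q − 1` vanish). (`2r < 7n` excludes saturated points by the final δ-law, so
the half law plus one applies.) -/
theorem two_mul_add_succ_le_card_filter_ne' (β : BilinComp (mulBilin k 2 2 n) ι) (q : ℕ)
    (h7 : 2 * Fintype.card ι < 7 * n) (hq : 2 * Fintype.card ι + 2 * q ≤ 7 * n)
    (X₀ : Matrix (Fin 2) (Fin 2) k) (hX₀ : IsUnit X₀.det) :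
    2 * n + q + 1 ≤ (Finset.univ.filter fun i => β.f i X₀ ≠ 0).card := by
  have h1 : 2 * n + 1 ≤ (Finset.univ.filter fun i => β.f i X₀ ≠ 0).card :=
    DeltaLaw.two_mul_add_one_le_card_filter_ne_of_lt β h7 X₀ hX₀
  have h' := eleven_mul_add_one_le β X₀ hX₀ h1
  omega

/-- **33-term `⟨2,2,10⟩` (any field; `𝔽₃` floor rung `⌈360/11⌉ = 33`): at least 23 = 2n + 3 of the 33 X-forms are nonzero at
every invertible point** (at most 10 vanish; half law: 11). -/
theorem twentythree_le_card_filter_ne_2210_33 (β : BilinComp (mulBilin k 2 2 10) ι) (hι : Fintype.card ι = 33)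
    (X₀ : Matrix (Fin 2) (Fin 2) k) (hX₀ : IsUnit X₀.det) : 23 ≤ (Finset.univ.filter fun i => β.f i X₀ ≠ 0).card :=
  two_mul_add_succ_le_card_filter_ne' β 2 (by omega) (by omega) X₀ hX₀

/-- **40-term `⟨2,2,12⟩` (any field; floor rung `⌈432/11⌉ = 40`): at least 27 = 2n + 3 of the 40 X-forms are nonzero at every
invertible point** (at most 13 vanish; half law: 14). -/
theorem twentyseven_le_card_filter_ne_2212_40 (β : BilinComp (mulBilin k 2 2 12) ι) (hι : Fintype.card ι = 40)
    (X₀ : Matrix (Fin 2) (Fin 2) k) (hX₀ : IsUnit X₀.det) : 27 ≤ (Finset.univ.filter fun i => β.f i X₀ ≠ 0).card :=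
  two_mul_add_succ_le_card_filter_ne' β 2 (by omega) (by omega) X₀ hX₀

/-- **46-term `⟨2,2,14⟩` (any field; floor rung `⌈504/11⌉ = 46`): at least 32 = 2n + 4 of the 46 X-forms are nonzero at every
invertible point** (at most 14 vanish; half law: 15). -/
theorem thirtytwo_le_card_filter_ne_2214_46 (β : BilinComp (mulBilin k 2 2 14) ι) (hι : Fintype.card ι = 46)
    (X₀ : Matrix (Fin 2) (Fin 2) k) (hX₀ : IsUnit X₀.det) : 32 ≤ (Finset.univ.filter fun i => β.f i X₀ ≠ 0).card :=
  two_mul_add_succ_le_card_filter_ne' β 3 (by omega) (by omega) X₀ hX₀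

end AnyField

end NearSplit

end Summit.MatrixMultiplication.OmegaCensus.SmallFormats
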